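import Mathlib.RingTheory.MvPolynomial.Homogeneous
import Literature.NumberTheory.Transcendental.NesterenkoEliminationNorms
import Literature.NumberTheory.Transcendental.PhilipponCriterionProjDist
import HarnessLib

/-!
# Small value estimates at rational translates (Nguyen–Roy 2016) — proofs, II: values of forms and the projective distance

Second proofs file towards `Literature.NumberTheory.Transcendental.nguyenRoy2016_thm_1` (Nguyen–Roy,
IJNT 12 (2016) = arXiv:1412.5163). Everything here is PROVED; no named facts and no new
definitions: the paper's length `𝓛(P)` (sum of the absolute values of the coefficients, §2 after
Lemma 6) is the tree's `Literature.NumberTheory.Transcendental.Nesterenko.l1Norm`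
(`NesterenkoEliminationNorms.lean`).

The projective distance of the paper (§2), `dist(α, β) = ‖α ∧ β‖ / (‖α‖ ‖β‖)` with maximum norms on
`ℂ³` and `⋀² ℂ³ ≅ ℂ³`, is literally the tree's `Literature.NumberTheory.Transcendental.Nesterenko.projDist`
(`NesterenkoElimination.lean`: `max_{i<j} |αᵢβⱼ − αⱼβᵢ| / (|α| |β|)`, any number `m + 1` of homogeneous
coordinates), so we state everything for `projDist` on `ℂ^{m+1}`.

## Content (general `m`; the paper has `m = 2`)

* `NguyenRoy.norm_prod_pow_mul_sub_le` — for exponents `μ, μ'` of degree `D` and `‖α‖, ‖β‖ ≤ 1`: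
  `|α^μ β^{μ'} − β^μ α^{μ'}| ≤ D · max_{i,j} |αᵢβⱼ − αⱼβᵢ|` (telescoping one variable at a time).
* `NguyenRoy.norm_eval_mul_eval_sub_le` — the "well known" bilinear estimate quoted in the proof of
  Lemma 6: for forms `P, Q ∈ ℂ[X₀, …, X_m]_D` and representatives of norm `≤ 1`,
  `|P(α)Q(β) − P(β)Q(α)| ≤ D 𝓛(P) 𝓛(Q) · max_{i,j} |αᵢβⱼ − αⱼβᵢ|`, and its `projDist` form
  `NguyenRoy.norm_eval_mul_eval_sub_le_projDist`.
* `NguyenRoy.norm_eval_le_norm_eval_add` — **Lemma 6**: for representatives of norm `1`,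
  `|P(α)| ≤ |P(β)| + D 𝓛(P) dist(α, β)` (apply the above to `Q = X_k^D` with `|β_k| = 1`).

## References

* [NguyenRoy2016] N. A. V. Nguyen, D. Roy, IJNT 12 (2016) = arXiv:1412.5163, §2: the distance,
  Lemma 6 and its proof ("It is well known that `|P(α)Q(β) − P(β)Q(α)| ≤ D𝓛(P)𝓛(Q) dist(α, β)`").
* [NesterenkoPhilippon2001] LNM 1752, Ch. 3 §4 (p. 40): the projective distance `‖φ̄ − ψ̄‖`.
-/

noncomputable section

open MvPolynomial Finset
open scoped NNReal
open Literature.NumberTheory.Transcendental.Nesterenko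

namespace Literature.NumberTheory.Transcendental

namespace NguyenRoy

variable {m : ℕ}

/-! ### The length of a monomial -/

/-- `𝓛(X_k^D) = 1` for the length `𝓛 = Nesterenko.l1Norm`. [folklore] -/
theorem l1Norm_X_pow {σ : Type*} (k : σ) (D : ℕ) : l1Norm ((X k : MvPolynomial σ ℂ) ^ D) = 1 := by
  rw [X_pow_eq_monomial, l1Norm_monomial, norm_one]

/-! ### Minors and monomials -/

/-- Every `2 × 2` minor `|αᵢβⱼ − αⱼβᵢ|` (any `i, j`) is at most `‖ᾱ − β̄‖ · |ᾱ| · |β̄|`. [folklore] -/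
theorem norm_minor_le_projDist_mul {α β : Fin (m + 1) → ℂ} (hα : α ≠ 0) (hβ : β ≠ 0)
    (i j : Fin (m + 1)) : ‖α i * β j - α j * β i‖ ≤ projDist α β * (‖α‖ * ‖β‖) := by
  rcases lt_trichotomy i j with h | rfl | h
  · exact PhilipponMain.norm_minor_le_projDist_mul hα hβ ⟨(i, j), h⟩
  · rw [sub_self, norm_zero]
    exact mul_nonneg (projDist_nonneg _ _) (mul_nonneg (norm_nonneg _) (norm_nonneg _))
  · rw [show α i * β j - α j * β i = -(α j * β i - α i * β j) by ring, norm_neg]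
    exact PhilipponMain.norm_minor_le_projDist_mul hα hβ ⟨(j, i), h⟩

/-- A product of powers of numbers of modulus `≤ 1` has modulus `≤ 1`. [folklore] -/
theorem norm_prod_pow_le_one {α : Fin (m + 1) → ℂ} (hα : ‖α‖ ≤ 1) (μ : Fin (m + 1) →₀ ℕ) :
    ‖∏ i, α i ^ μ i‖ ≤ 1 := by
  rw [norm_prod]
  refine Finset.prod_le_one (fun i _ => norm_nonneg _) fun i _ => ?_
  rw [norm_pow]
  exact pow_le_one₀ (norm_nonneg _) ((norm_le_pi_norm α i).trans hα)

/-- Peeling one variable off a monomial: `α^{μ₀ + eᵢ} = α^{μ₀} · αᵢ`. [folklore] -/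
theorem prod_pow_add_single (α : Fin (m + 1) → ℂ) (μ₀ : Fin (m + 1) →₀ ℕ) (i : Fin (m + 1)) :
    ∏ j, α j ^ (μ₀ + Finsupp.single i 1 : Fin (m + 1) →₀ ℕ) j = (∏ j, α j ^ μ₀ j) * α i := by
  classical
  simp only [Finsupp.coe_add, Pi.add_apply, pow_add, Finset.prod_mul_distrib, Finsupp.single_apply,
    pow_ite, pow_one, pow_zero, Finset.prod_ite_eq, Finset.mem_univ, if_true]

/-- **Monomials at two points.** If `‖α‖, ‖β‖ ≤ 1` and every minor satisfies `|αᵢβⱼ − αⱼβᵢ| ≤ δ`,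
then for exponents `μ, μ'` of the same degree `d`, `|α^μ β^{μ'} − β^μ α^{μ'}| ≤ d δ` (telescoping:
`α^{μ₀+eᵢ} β^{μ₀'+eⱼ} − β^{μ₀+eᵢ} α^{μ₀'+eⱼ} = αᵢβⱼ (α^{μ₀}β^{μ₀'} − β^{μ₀}α^{μ₀'}) + (αᵢβⱼ − βᵢαⱼ) β^{μ₀} α^{μ₀'}`).
[cite: NguyenRoy2016, Lemma 6 (proof, "well known")] -/
theorem norm_prod_pow_mul_sub_le {α β : Fin (m + 1) → ℂ} (hα : ‖α‖ ≤ 1) (hβ : ‖β‖ ≤ 1) {δ : ℝ}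
    (hδ0 : 0 ≤ δ) (hδ : ∀ i j, ‖α i * β j - α j * β i‖ ≤ δ) :
    ∀ (d : ℕ) (μ μ' : Fin (m + 1) →₀ ℕ), μ.degree = d → μ'.degree = d →
      ‖(∏ i, α i ^ μ i) * (∏ i, β i ^ μ' i) - (∏ i, β i ^ μ i) * (∏ i, α i ^ μ' i)‖ ≤ d * δ := by
  intro d
  induction d with
  | zero =>
    intro μ μ' hμ hμ'
    rw [(Finsupp.degree_eq_zero_iff μ).mp hμ, (Finsupp.degree_eq_zero_iff μ').mp hμ']
    simp
  | succ d ih =>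
    intro μ μ' hμ hμ'
    -- pick a variable occurring in `μ` and one occurring in `μ'`
    have hμne : μ ≠ 0 := fun h => by rw [h, map_zero] at hμ; exact Nat.succ_ne_zero d hμ.symm
    have hμne' : μ' ≠ 0 := fun h => by rw [h, map_zero] at hμ'; exact Nat.succ_ne_zero d hμ'.symm
    obtain ⟨i, hi⟩ : ∃ i, μ i ≠ 0 := by
      by_contra! h; exact hμne (Finsupp.ext h)
    obtain ⟨j, hj⟩ : ∃ j, μ' j ≠ 0 := by
      by_contra! h; exact hμne' (Finsupp.ext h)
    set μ₀ := μ - Finsupp.single i 1 with hμ₀_def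
    set μ₀' := μ' - Finsupp.single j 1 with hμ₀'_def
    have hdec : μ = μ₀ + Finsupp.single i 1 :=
      (tsub_add_cancel_of_le (Finsupp.single_le_iff.mpr (Nat.one_le_iff_ne_zero.mpr hi))).symm
    have hdec' : μ' = μ₀' + Finsupp.single j 1 :=
      (tsub_add_cancel_of_le (Finsupp.single_le_iff.mpr (Nat.one_le_iff_ne_zero.mpr hj))).symm
    have hdeg : μ₀.degree = d := by
      have := hμ; rw [hdec, map_add, Finsupp.degree_single] at this; omega
    have hdeg' : μ₀'.degree = d := by
      have := hμ'; rw [hdec', map_add, Finsupp.degree_single] at this; omega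
    rw [hdec, hdec', prod_pow_add_single, prod_pow_add_single, prod_pow_add_single,
      prod_pow_add_single]
    set A := ∏ k, α k ^ μ₀ k
    set B := ∏ k, β k ^ μ₀' k
    set A' := ∏ k, β k ^ μ₀ k
    set B' := ∏ k, α k ^ μ₀' k
    have key : A * α i * (B * β j) - A' * β i * (B' * α j) =
        (α i * β j) * (A * B - A' * B') + (α i * β j - α j * β i) * (A' * B') := by ring
    rw [key]
    have h1 : ‖α i * β j‖ ≤ 1 := by
      rw [norm_mul]
      exact mul_le_one₀ ((norm_le_pi_norm α i).trans hα) (norm_nonneg _)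
        ((norm_le_pi_norm β j).trans hβ)
    have h2 : ‖A' * B'‖ ≤ 1 := by
      rw [norm_mul]
      exact mul_le_one₀ (norm_prod_pow_le_one hβ μ₀) (norm_nonneg _) (norm_prod_pow_le_one hα μ₀')
    have hIH : ‖A * B - A' * B'‖ ≤ d * δ := ih μ₀ μ₀' hdeg hdeg'
    calc ‖α i * β j * (A * B - A' * B') + (α i * β j - α j * β i) * (A' * B')‖
        ≤ ‖α i * β j * (A * B - A' * B')‖ + ‖(α i * β j - α j * β i) * (A' * B')‖ :=
          norm_add_le _ _
      _ = ‖α i * β j‖ * ‖A * B - A' * B'‖ + ‖α i * β j - α j * β i‖ * ‖A' * B'‖ := by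
          rw [norm_mul (α i * β j) (A * B - A' * B'), norm_mul (α i * β j - α j * β i) (A' * B')]
      _ ≤ 1 * (d * δ) + δ * 1 := by
          gcongr
          exact hδ i j
      _ = (d + 1 : ℕ) * δ := by push_cast; ring

/-! ### Values of forms at two points -/

/-- The degree of a monomial in the support of a form. [folklore] -/
theorem degree_eq_of_isHomogeneous {σ : Type*} {P : MvPolynomial σ ℂ} {D : ℕ} (hP : P.IsHomogeneous D)
    {μ : σ →₀ ℕ} (hμ : μ ∈ P.support) : μ.degree = D := by
  have h := hP (mem_support_iff.mp hμ)
  rw [Finsupp.degree_eq_weight_one]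
  exact h

/-- **The bilinear estimate** ("well known", Nguyen–Roy 2016, proof of Lemma 6): for forms
`P, Q ∈ ℂ[X₀, …, X_m]` of degree `D`, points `α, β ∈ ℂ^{m+1}` of norm `≤ 1` and a bound `δ` for the
minors `|αᵢβⱼ − αⱼβᵢ|`, one has `|P(α)Q(β) − P(β)Q(α)| ≤ D · δ · 𝓛(P) 𝓛(Q)` (`𝓛 = Nesterenko.l1Norm`).
[cite: NguyenRoy2016, Lemma 6 (proof)] -/
theorem norm_eval_mul_eval_sub_le {α β : Fin (m + 1) → ℂ} (hα : ‖α‖ ≤ 1) (hβ : ‖β‖ ≤ 1) {δ : ℝ}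
    (hδ0 : 0 ≤ δ) (hδ : ∀ i j, ‖α i * β j - α j * β i‖ ≤ δ) {P Q : MvPolynomial (Fin (m + 1)) ℂ}
    {D : ℕ} (hP : P.IsHomogeneous D) (hQ : Q.IsHomogeneous D) :
    ‖eval α P * eval β Q - eval β P * eval α Q‖ ≤ D * δ * l1Norm P * l1Norm Q := by
  have hexp : eval α P * eval β Q - eval β P * eval α Q =
      ∑ μ ∈ P.support, ∑ μ' ∈ Q.support, P.coeff μ * Q.coeff μ' *
        ((∏ i, α i ^ μ i) * (∏ i, β i ^ μ' i) - (∏ i, β i ^ μ i) * (∏ i, α i ^ μ' i)) := by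
    simp only [eval_eq', Finset.sum_mul_sum, ← Finset.sum_sub_distrib]
    refine Finset.sum_congr rfl fun μ _ => Finset.sum_congr rfl fun μ' _ => ?_
    ring
  rw [hexp]
  calc ‖∑ μ ∈ P.support, ∑ μ' ∈ Q.support, P.coeff μ * Q.coeff μ' *
        ((∏ i, α i ^ μ i) * (∏ i, β i ^ μ' i) - (∏ i, β i ^ μ i) * (∏ i, α i ^ μ' i))‖
      ≤ ∑ μ ∈ P.support, ∑ μ' ∈ Q.support, ‖P.coeff μ‖ * ‖Q.coeff μ'‖ * (D * δ) := by
        refine (norm_sum_le _ _).trans (Finset.sum_le_sum fun μ hμ => ?_)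
        refine (norm_sum_le _ _).trans (Finset.sum_le_sum fun μ' hμ' => ?_)
        rw [norm_mul, norm_mul]
        gcongr
        exact norm_prod_pow_mul_sub_le hα hβ hδ0 hδ D μ μ' (degree_eq_of_isHomogeneous hP hμ)
          (degree_eq_of_isHomogeneous hQ hμ')
    _ = D * δ * l1Norm P * l1Norm Q := by
        rw [l1Norm, l1Norm, mul_assoc, Finset.sum_mul_sum]
        simp only [Finset.mul_sum]
        refine Finset.sum_congr rfl fun μ _ => Finset.sum_congr rfl fun μ' _ => ?_
        ring

/-- The bilinear estimate with the projective distance: for non-zero `α, β` of norm `≤ 1`,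
`|P(α)Q(β) − P(β)Q(α)| ≤ D 𝓛(P) 𝓛(Q) ‖ᾱ − β̄‖`. [cite: NguyenRoy2016, Lemma 6 (proof)] -/
theorem norm_eval_mul_eval_sub_le_projDist {α β : Fin (m + 1) → ℂ} (hα0 : α ≠ 0) (hβ0 : β ≠ 0)
    (hα : ‖α‖ ≤ 1) (hβ : ‖β‖ ≤ 1) {P Q : MvPolynomial (Fin (m + 1)) ℂ} {D : ℕ}
    (hP : P.IsHomogeneous D) (hQ : Q.IsHomogeneous D) :
    ‖eval α P * eval β Q - eval β P * eval α Q‖ ≤ D * projDist α β * l1Norm P * l1Norm Q := by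
  refine norm_eval_mul_eval_sub_le hα hβ (projDist_nonneg α β) (fun i j => ?_) hP hQ
  refine (norm_minor_le_projDist_mul hα0 hβ0 i j).trans ?_
  have h1 : ‖α‖ * ‖β‖ ≤ 1 := mul_le_one₀ hα (norm_nonneg _) hβ
  calc projDist α β * (‖α‖ * ‖β‖) ≤ projDist α β * 1 :=
        mul_le_mul_of_nonneg_left h1 (projDist_nonneg α β)
    _ = projDist α β := mul_one _

/-- **Nguyen–Roy 2016, Lemma 6.** Let `α, β ∈ ℙ^m(ℂ)` have representatives `ᾱ, β̄ ∈ ℂ^{m+1}` of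
(maximum) norm `1`, and let `P ∈ ℂ[X₀, …, X_m]_D`. Then `|P(ᾱ)| ≤ |P(β̄)| + D 𝓛(P) dist(α, β)`
(`dist` = `Nesterenko.projDist`; the paper has `m = 2`). [cite: NguyenRoy2016, Lemma 6] -/
theorem norm_eval_le_norm_eval_add {α β : Fin (m + 1) → ℂ} (hα : ‖α‖ = 1) (hβ : ‖β‖ = 1)
    {P : MvPolynomial (Fin (m + 1)) ℂ} {D : ℕ} (hP : P.IsHomogeneous D) :
    ‖eval α P‖ ≤ ‖eval β P‖ + D * l1Norm P * projDist α β := by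
  have hα0 : α ≠ 0 := fun h => by rw [h, norm_zero] at hα; exact zero_ne_one hα
  have hβ0 : β ≠ 0 := fun h => by rw [h, norm_zero] at hβ; exact zero_ne_one hβ
  -- a coordinate `k` with `|β_k| = ‖β‖ = 1`
  obtain ⟨k, hk⟩ := PhilipponMain.exists_norm_eq_norm_apply β
  rw [hβ] at hk
  have hQ : ((X k : MvPolynomial (Fin (m + 1)) ℂ) ^ D).IsHomogeneous D := by
    simpa using (isHomogeneous_X ℂ k).pow D
  have h := norm_eval_mul_eval_sub_le_projDist hα0 hβ0 hα.le hβ.le hP hQ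
  rw [l1Norm_X_pow, mul_one, map_pow, map_pow, eval_X, eval_X] at h
  -- `|P(α) β_k^D| = |P(α)|`, `|P(β) α_k^D| ≤ |P(β)|`
  have e1 : ‖eval α P * β k ^ D‖ = ‖eval α P‖ := by rw [norm_mul, norm_pow, ← hk, one_pow, mul_one]
  have e2 : ‖eval β P * α k ^ D‖ ≤ ‖eval β P‖ := by
    rw [norm_mul, norm_pow]
    refine mul_le_of_le_one_right (norm_nonneg _) (pow_le_one₀ (norm_nonneg _) ?_)
    exact (norm_le_pi_norm α k).trans hα.le
  calc ‖eval α P‖ = ‖eval α P * β k ^ D‖ := e1.symm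
    _ = ‖eval β P * α k ^ D + (eval α P * β k ^ D - eval β P * α k ^ D)‖ := by ring_nf
    _ ≤ ‖eval β P * α k ^ D‖ + ‖eval α P * β k ^ D - eval β P * α k ^ D‖ := norm_add_le _ _
    _ ≤ ‖eval β P‖ + D * projDist α β * l1Norm P := add_le_add e2 h
    _ = ‖eval β P‖ + D * l1Norm P * projDist α β := by ring

end NguyenRoy

end Literature.NumberTheory.Transcendental
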